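import Summits.HubbardSuperconductivity.HubbardSuperconductivity.Theorems.AnisotropyChordInsertionEntropyJastrowResamplingKL

/-!
# Route `AnisotropyChord` / H0 rotor rung: the RESAMPLING ROUTE for a general Jastrow kernel — the particle–hole
# floor from the energy floor by a SECOND resampling, and the end-to-end theorems
# (kernel-generic port of theory seat `hubbard-h0-rotor-theory-1`, Sketch9 Part P′, memo ROTOR-THEORY-9 §135(t))

For an even kernel `0 ≤ W ≤ B` with `W 0 = 0` on a finite abelian group `G` and the canonical state `jAmp W N` with
`2 ≤ N`, `2N ≤ |G| ≤ 3N` (e.g. half filling):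
* `jAmp_caseC_bound`, `jAmp_caseD_bound` (move inequality with an invariant factor, Jensen over the target site +
  energy floor) and **`jastrowParticleHoleFloor_of_energyFloor`**:
  `JastrowEnergyFloor W N E ⟹ JastrowParticleHoleFloor W N (e^{−(E + 4(E + 2e^E))}/8)`;
* `resamplingConst B E` (the explicit exponent) and the END-TO-END theorems
  **`condensateDensity_jAmp_ge_of_energyFloor`** (energy floor alone ⟹ condensate floor) and
  **`condensateDensity_jAmp_ge_of_psd`** (`KernelPSDShift W D`, `D ≥ 0` ⟹
  `n₀/|G| ≥ (N/|G|)(1 − N/|G|)·exp(−resamplingConst B D/2)`): Bose–Einstein condensation of the canonical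
  Jastrow / Rokhsar–Kivelson state from positive-semidefiniteness of the pair kernel ALONE, uniformly in `|G|`.
-/

set_option linter.dupNamespace false

noncomputable section

open Finset

namespace Summit.HubbardSuperconductivity.HubbardSuperconductivity.Theorems.AnisotropyChord.InsertionEntropy

section JastrowParticleHole

variable {G : Type} [AddCommGroup G] [Fintype G] [DecidableEq G]

/-- **CASE C (x, y both occupied; resample y's particle onto an empty site):**
`(|G| − N) e^{−E} · E[n_x n_y e^{Φ_y − c}] ≤ N · P(x occ, y emp)`. (theory seat Sketch9 Part P′ `caseC_bound`) [folklore] -/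
theorem jAmp_caseC_bound (W : G → ℝ) (hWe : ∀ z, W (-z) = W z) (hW0 : W 0 = 0) (hWnn : ∀ z, 0 ≤ W z)
    (N : ℕ) (hN2 : 2 ≤ N) (h2N : 2 * N ≤ Fintype.card G) {E : ℝ} (hE : 0 ≤ E) (hEF : JastrowEnergyFloor W N E)
    (x y : G) (hxy : x ≠ y) :
    ((Fintype.card G : ℝ) - (N : ℝ)) * Real.exp (-E)
        * wmean (jAmp W N) (fun σ => occ σ x * occ σ y
            * Real.exp (jPot W y σ - jMeanPot W N))
      ≤ (N : ℝ) * probPH (jAmp W N) x y := by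
  have hZ1 : wnorm (jAmp W N) = 1 := wnorm_jAmp W N (by omega)
  have hZpos : 0 < wnorm (jAmp W N) := by rw [hZ1]; exact one_pos
  have hN2r : (2 : ℝ) ≤ (N : ℝ) := by exact_mod_cast hN2
  have hNV : 2 * (N : ℝ) ≤ (Fintype.card G : ℝ) := by exact_mod_cast h2N
  have hGpos : 0 < Fintype.card G := by omega
  -- per-site move inequality, summed over the target site w
  have hw : ∀ w : G,
      ∑ σ, jAmp W N σ ^ 2 * (occ σ x * (occ σ y * (1 - occ σ w))
          * Real.exp (jPot W y σ - jPot W w σ))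
        ≤ ∑ σ, jAmp W N σ ^ 2 * (occ σ x * ((1 - occ σ y) * occ σ w)) := by
    intro w
    by_cases hxw : x = w
    · subst hxw
      have h0 : ∀ σ : G → Fin 2, occ σ x * (occ σ y * (1 - occ σ x)) = 0 := fun σ => by
        unfold occ; split_ifs <;> ring
      simp_rw [h0, zero_mul, mul_zero, Finset.sum_const_zero]
      exact Finset.sum_nonneg fun σ _ => mul_nonneg (sq_nonneg _)
        (mul_nonneg ((occ_mem_unit σ x).1) (mul_nonneg (by linarith [(occ_mem_unit σ y).2]) ((occ_mem_unit σ x).1)))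
    · exact wsum_move_term_le_mul W hWe hW0 hWnn N y w (fun σ => occ σ x)
        (fun σ => occ_comp_swap_of_ne σ y w x hxy hxw) (fun σ => (occ_mem_unit σ x).1)
  have hmean : wmean (jAmp W N) (fun σ => ∑ w, occ σ x * (occ σ y * (1 - occ σ w))
        * Real.exp (jPot W y σ - jPot W w σ))
      ≤ wmean (jAmp W N) (fun σ => ∑ w, occ σ x * ((1 - occ σ y) * occ σ w)) := by
    rw [wmean_finset_sum _ Finset.univ (fun w σ => occ σ x * (occ σ y * (1 - occ σ w))
        * Real.exp (jPot W y σ - jPot W w σ)),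
      wmean_finset_sum _ Finset.univ (fun w σ => occ σ x * ((1 - occ σ y) * occ σ w))]
    refine Finset.sum_le_sum fun w _ => ?_
    unfold wmean wsum
    exact div_le_div_of_nonneg_right (hw w) hZpos.le
  -- RHS = N · P(x occ, y emp)
  have hR : wmean (jAmp W N) (fun σ => ∑ w, occ σ x * ((1 - occ σ y) * occ σ w))
      = (N : ℝ) * probPH (jAmp W N) x y := by
    unfold probPH
    rw [← wmean_smul]
    refine wmean_congr_support _ fun σ hσ => ?_
    have hsumN : ∑ u, occ σ u = (N : ℝ) := sum_occ_jAmp W N σ hσ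
    rw [← hsumN, Finset.sum_mul]
    exact Finset.sum_congr rfl fun w _ => by ring
  -- LHS ≥ (V − N) e^{−E} E[C e^{Φ_y − c}]  (Jensen over w + energy floor)
  have hLft : wmean (jAmp W N) (fun σ => (((Fintype.card G : ℝ) - (N : ℝ)) * Real.exp (-E))
        * (occ σ x * occ σ y * Real.exp (jPot W y σ - jMeanPot W N)))
      ≤ wmean (jAmp W N) (fun σ => ∑ w, occ σ x * (occ σ y * (1 - occ σ w))
        * Real.exp (jPot W y σ - jPot W w σ)) := by
    refine wmean_mono_support _ fun σ hσ => ?_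
    have hpc := jAmp_support W N σ hσ
    have hsumN : ∑ u, occ σ u = (N : ℝ) := by rw [sum_occ_eq_particleCount, hpc]
    have hsumH : ∑ v, (1 - occ σ v) = (Fintype.card G : ℝ) - (N : ℝ) := by
      rw [Finset.sum_sub_distrib, Finset.sum_const, Finset.card_univ, hsumN]; simp
    have hJ := mass_mul_exp_avg_le (fun w => 1 - occ σ w)
      (fun w => jPot W y σ - jPot W w σ)
      ((Fintype.card G : ℝ) - (N : ℝ)) (by linarith) (fun w => by linarith [(occ_mem_unit σ w).2]) hsumH
    have hbk := sum_emp_pot_sub_eq W N σ hpc hGpos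
    have hfl := hEF σ hpc
    have havg : jPot W y σ - jMeanPot W N - E
        ≤ (∑ w, (1 - occ σ w) * (jPot W y σ - jPot W w σ)) / ((Fintype.card G : ℝ) - (N : ℝ)) := by
      rw [le_div_iff₀ (by linarith)]
      have : ∑ w, (1 - occ σ w) * (jPot W y σ - jPot W w σ)
          = (jPot W y σ - jMeanPot W N) * ∑ w, (1 - occ σ w)
            - ∑ w, (1 - occ σ w) * (jPot W w σ - jMeanPot W N) := by
        rw [Finset.mul_sum, ← Finset.sum_sub_distrib]; exact Finset.sum_congr rfl fun w _ => by ring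
      rw [this, hsumH, hbk]
      have hNE : (N : ℝ) * E ≤ ((Fintype.card G : ℝ) - (N : ℝ)) * E := mul_le_mul_of_nonneg_right (by linarith) hE
      nlinarith
    have hexp : ((Fintype.card G : ℝ) - (N : ℝ)) * Real.exp (-E) * Real.exp (jPot W y σ - jMeanPot W N)
        ≤ ∑ w, (1 - occ σ w) * Real.exp (jPot W y σ - jPot W w σ) := by
      calc ((Fintype.card G : ℝ) - (N : ℝ)) * Real.exp (-E) * Real.exp (jPot W y σ - jMeanPot W N)
          = ((Fintype.card G : ℝ) - (N : ℝ)) * Real.exp (jPot W y σ - jMeanPot W N - E) := by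
            rw [mul_assoc, ← Real.exp_add]; ring_nf
        _ ≤ ((Fintype.card G : ℝ) - (N : ℝ)) * Real.exp ((∑ w, (1 - occ σ w)
              * (jPot W y σ - jPot W w σ)) / ((Fintype.card G : ℝ) - (N : ℝ))) :=
            mul_le_mul_of_nonneg_left (Real.exp_le_exp.mpr havg) (by linarith)
        _ ≤ _ := hJ
    have hC0 : 0 ≤ occ σ x * occ σ y := mul_nonneg ((occ_mem_unit σ x).1) ((occ_mem_unit σ y).1)
    calc ((Fintype.card G : ℝ) - (N : ℝ)) * Real.exp (-E)
          * (occ σ x * occ σ y * Real.exp (jPot W y σ - jMeanPot W N))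
        = (occ σ x * occ σ y) * (((Fintype.card G : ℝ) - (N : ℝ)) * Real.exp (-E)
            * Real.exp (jPot W y σ - jMeanPot W N)) := by ring
      _ ≤ (occ σ x * occ σ y)
            * ∑ w, (1 - occ σ w) * Real.exp (jPot W y σ - jPot W w σ) :=
          mul_le_mul_of_nonneg_left hexp hC0
      _ = _ := by rw [Finset.mul_sum]; exact Finset.sum_congr rfl fun w _ => by ring
  rw [wmean_smul] at hLft
  linarith [hLft, hmean, hR]

/-- **CASE D (x, y both empty; resample an occupied site's particle onto y):**
`N e^{−E} · E[(1−n_x)(1−n_y) e^{−(Φ_y − c)}] ≤ (|G| − N) · E[(1−n_x) n_y]`. (theory seat Sketch9 Part P′ `caseD_bound`) [folklore] -/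
theorem jAmp_caseD_bound (W : G → ℝ) (hWe : ∀ z, W (-z) = W z) (hW0 : W 0 = 0) (hWnn : ∀ z, 0 ≤ W z)
    (N : ℕ) (hN2 : 2 ≤ N) (h2N : 2 * N ≤ Fintype.card G) {E : ℝ} (hEF : JastrowEnergyFloor W N E)
    (x y : G) (hxy : x ≠ y) :
    (N : ℝ) * Real.exp (-E)
        * wmean (jAmp W N) (fun σ => (1 - occ σ x) * (1 - occ σ y)
            * Real.exp (-(jPot W y σ - jMeanPot W N)))
      ≤ ((Fintype.card G : ℝ) - (N : ℝ)) * wmean (jAmp W N) (fun σ => (1 - occ σ x) * occ σ y) := by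
  have hZ1 : wnorm (jAmp W N) = 1 := wnorm_jAmp W N (by omega)
  have hZpos : 0 < wnorm (jAmp W N) := by rw [hZ1]; exact one_pos
  have hN2r : (2 : ℝ) ≤ (N : ℝ) := by exact_mod_cast hN2
  have hNV : 2 * (N : ℝ) ≤ (Fintype.card G : ℝ) := by exact_mod_cast h2N
  have hGpos : 0 < Fintype.card G := by omega
  have hw : ∀ w : G,
      ∑ σ, jAmp W N σ ^ 2 * ((1 - occ σ x) * (occ σ w * (1 - occ σ y))
          * Real.exp (jPot W w σ - jPot W y σ))
        ≤ ∑ σ, jAmp W N σ ^ 2 * ((1 - occ σ x) * ((1 - occ σ w) * occ σ y)) := by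
    intro w
    by_cases hxw : x = w
    · subst hxw
      have h0 : ∀ σ : G → Fin 2, (1 - occ σ x) * (occ σ x * (1 - occ σ y)) = 0 := fun σ => by
        unfold occ; split_ifs <;> ring
      simp_rw [h0, zero_mul, mul_zero, Finset.sum_const_zero]
      exact Finset.sum_nonneg fun σ _ => mul_nonneg (sq_nonneg _)
        (mul_nonneg (by linarith [(occ_mem_unit σ x).2])
          (mul_nonneg (by linarith [(occ_mem_unit σ x).2]) ((occ_mem_unit σ y).1)))
    · exact wsum_move_term_le_mul W hWe hW0 hWnn N w y (fun σ => 1 - occ σ x)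
        (fun σ => by rw [occ_comp_swap_of_ne σ w y x hxw hxy]) (fun σ => by linarith [(occ_mem_unit σ x).2])
  have hmean : wmean (jAmp W N) (fun σ => ∑ w, (1 - occ σ x) * (occ σ w * (1 - occ σ y))
        * Real.exp (jPot W w σ - jPot W y σ))
      ≤ wmean (jAmp W N) (fun σ => ∑ w, (1 - occ σ x) * ((1 - occ σ w) * occ σ y)) := by
    rw [wmean_finset_sum _ Finset.univ (fun w σ => (1 - occ σ x) * (occ σ w * (1 - occ σ y))
        * Real.exp (jPot W w σ - jPot W y σ)),
      wmean_finset_sum _ Finset.univ (fun w σ => (1 - occ σ x) * ((1 - occ σ w) * occ σ y))]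
    refine Finset.sum_le_sum fun w _ => ?_
    unfold wmean wsum
    exact div_le_div_of_nonneg_right (hw w) hZpos.le
  have hR : wmean (jAmp W N) (fun σ => ∑ w, (1 - occ σ x) * ((1 - occ σ w) * occ σ y))
      = ((Fintype.card G : ℝ) - (N : ℝ)) * wmean (jAmp W N) (fun σ => (1 - occ σ x) * occ σ y) := by
    rw [← wmean_smul]
    refine wmean_congr_support _ fun σ hσ => ?_
    have hsumN : ∑ u, occ σ u = (N : ℝ) := sum_occ_jAmp W N σ hσ
    have hsumH : ∑ v, (1 - occ σ v) = (Fintype.card G : ℝ) - (N : ℝ) := by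
      rw [Finset.sum_sub_distrib, Finset.sum_const, Finset.card_univ, hsumN]; simp
    rw [← hsumH, Finset.sum_mul]
    exact Finset.sum_congr rfl fun w _ => by ring
  have hLft : wmean (jAmp W N) (fun σ => ((N : ℝ) * Real.exp (-E))
        * ((1 - occ σ x) * (1 - occ σ y) * Real.exp (-(jPot W y σ - jMeanPot W N))))
      ≤ wmean (jAmp W N) (fun σ => ∑ w, (1 - occ σ x) * (occ σ w * (1 - occ σ y))
        * Real.exp (jPot W w σ - jPot W y σ)) := by
    refine wmean_mono_support _ fun σ hσ => ?_
    have hpc := jAmp_support W N σ hσ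
    have hsumN : ∑ u, occ σ u = (N : ℝ) := by rw [sum_occ_eq_particleCount, hpc]
    have hJ := mass_mul_exp_avg_le (fun w => occ σ w)
      (fun w => jPot W w σ - jPot W y σ)
      ((N : ℝ)) (by linarith) (fun w => (occ_mem_unit σ w).1) hsumN
    have hfl := hEF σ hpc
    have havg : -(jPot W y σ - jMeanPot W N) - E
        ≤ (∑ w, occ σ w * (jPot W w σ - jPot W y σ)) / (N : ℝ) := by
      rw [le_div_iff₀ (by linarith)]
      have : ∑ w, occ σ w * (jPot W w σ - jPot W y σ)
          = ∑ w, occ σ w * jPot W w σ - jPot W y σ * ∑ w, occ σ w := by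
        rw [Finset.mul_sum, ← Finset.sum_sub_distrib]; exact Finset.sum_congr rfl fun w _ => by ring
      rw [this, hsumN]
      nlinarith
    have hexp : (N : ℝ) * Real.exp (-E) * Real.exp (-(jPot W y σ - jMeanPot W N))
        ≤ ∑ w, occ σ w * Real.exp (jPot W w σ - jPot W y σ) := by
      calc (N : ℝ) * Real.exp (-E) * Real.exp (-(jPot W y σ - jMeanPot W N))
          = (N : ℝ) * Real.exp (-(jPot W y σ - jMeanPot W N) - E) := by
            rw [mul_assoc, ← Real.exp_add]; ring_nf
        _ ≤ (N : ℝ) * Real.exp ((∑ w, occ σ w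
              * (jPot W w σ - jPot W y σ)) / (N : ℝ)) :=
            mul_le_mul_of_nonneg_left (Real.exp_le_exp.mpr havg) (by linarith)
        _ ≤ _ := hJ
    have hD0 : 0 ≤ (1 - occ σ x) * (1 - occ σ y) :=
      mul_nonneg (by linarith [(occ_mem_unit σ x).2]) (by linarith [(occ_mem_unit σ y).2])
    calc (N : ℝ) * Real.exp (-E)
          * ((1 - occ σ x) * (1 - occ σ y) * Real.exp (-(jPot W y σ - jMeanPot W N)))
        = ((1 - occ σ x) * (1 - occ σ y)) * ((N : ℝ) * Real.exp (-E)
            * Real.exp (-(jPot W y σ - jMeanPot W N))) := by ring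
      _ ≤ ((1 - occ σ x) * (1 - occ σ y))
            * ∑ w, occ σ w * Real.exp (jPot W w σ - jPot W y σ) :=
          mul_le_mul_of_nonneg_left hexp hD0
      _ = _ := by rw [Finset.mul_sum]; exact Finset.sum_congr rfl fun w _ => by ring
  rw [wmean_smul] at hLft
  linarith [hLft, hmean, hR]

set_option maxHeartbeats 400000 in
/-- **T0 FROM THE ENERGY FLOOR (PROVED, kernel-generic):** the particle–hole floor follows from the energy floor by a
second resampling: `JastrowEnergyFloor W N E ⟹ JastrowParticleHoleFloor W N (e^{−(E + 4(E + 2e^E))}/8)`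
(`W ≥ 0` even, `W 0 = 0`, `2 ≤ N`, `2N ≤ |G| ≤ 3N`). (theory seat Sketch9 Part P′ `sheetParticleHoleFloor_of_energyFloor`) [folklore] -/
theorem jastrowParticleHoleFloor_of_energyFloor (W : G → ℝ) (hWe : ∀ z, W (-z) = W z) (hW0 : W 0 = 0)
    (hWnn : ∀ z, 0 ≤ W z) (N : ℕ) (hN2 : 2 ≤ N) (h2N : 2 * N ≤ Fintype.card G) (h3N : Fintype.card G ≤ 3 * N)
    {E : ℝ} (hE : 0 ≤ E) (hEF : JastrowEnergyFloor W N E) :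
    JastrowParticleHoleFloor W N (Real.exp (-(E + 4 * (E + 2 * Real.exp E))) / 8) := by
  intro x y hxy
  have hZ1 : wnorm (jAmp W N) = 1 := wnorm_jAmp W N (by omega)
  have hZpos : 0 < wnorm (jAmp W N) := by rw [hZ1]; exact one_pos
  have hZ : wnorm (jAmp W N) ≠ 0 := hZpos.ne'
  have hN2r : (2 : ℝ) ≤ (N : ℝ) := by exact_mod_cast hN2
  have hNV : 2 * (N : ℝ) ≤ (Fintype.card G : ℝ) := by exact_mod_cast h2N
  have h3Nr : (Fintype.card G : ℝ) ≤ 3 * (N : ℝ) := by exact_mod_cast h3N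
  have hK0 : 0 ≤ E + 2 * Real.exp E := by positivity
  have hKy := wmean_abs_pot_le W hWe hW0 hWnn N hN2 h2N hE hEF y
  -- the four events
  have htot : probPH (jAmp W N) x y
      + wmean (jAmp W N) (fun σ => (1 - occ σ x) * occ σ y)
      + wmean (jAmp W N) (fun σ => occ σ x * occ σ y)
      + wmean (jAmp W N) (fun σ => (1 - occ σ x) * (1 - occ σ y)) = 1 := by
    unfold probPH
    rw [← wmean_add, ← wmean_add, ← wmean_add, wmean_congr (jAmp W N) (g := fun _ => (1 : ℝ)) (fun σ => by ring)]
    exact wmean_const _ 1 hZ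
  have hB : wmean (jAmp W N) (fun σ => (1 - occ σ x) * occ σ y) = probPH (jAmp W N) x y := by
    have e1 : probPH (jAmp W N) y x = probPH (jAmp W N) x y := by
      rw [probPH_eq _ y x (Ne.symm hxy), probPH_eq _ x y hxy, pairMass_symm_jAmp W N y x]
    rw [← e1]; unfold probPH; exact wmean_congr _ fun σ => by ring
  have hexp1 : Real.exp (-(E + 4 * (E + 2 * Real.exp E))) = Real.exp (-E) * Real.exp (-(4 * (E + 2 * Real.exp E))) := by
    rw [← Real.exp_add]; ring_nf
  have hexple : Real.exp (-(E + 4 * (E + 2 * Real.exp E))) ≤ 1 := by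
    rw [Real.exp_le_one_iff]; linarith
  by_cases hp : 1 / 4 < probPH (jAmp W N) x y
  · linarith
  · rw [not_lt] at hp
    rcases le_or_gt (1 / 4) (wmean (jAmp W N) (fun σ => occ σ x * occ σ y)) with hC | hC
    · -- CASE C
      have hC0 : ∀ σ : G → Fin 2, 0 ≤ occ σ x * occ σ y := fun σ =>
        mul_nonneg ((occ_mem_unit σ x).1) ((occ_mem_unit σ y).1)
      have hmC : 0 < wmean (jAmp W N) (fun σ => occ σ x * occ σ y) := by linarith
      have hJ := wmean_mul_exp_ge (jAmp W N) (fun σ => occ σ x * occ σ y)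
        (fun σ => jPot W y σ - jMeanPot W N) hZpos hC0 hmC
      have hCx : -(E + 2 * Real.exp E)
          ≤ wmean (jAmp W N) (fun σ => occ σ x * occ σ y * (jPot W y σ - jMeanPot W N)) := by
        have h1 : wmean (jAmp W N) (fun σ => (-1) * |jPot W y σ - jMeanPot W N|)
            ≤ wmean (jAmp W N) (fun σ => occ σ x * occ σ y * (jPot W y σ - jMeanPot W N)) := by
          refine wmean_mono _ fun σ => ?_
          have hc1 : occ σ x * occ σ y ≤ 1 := by
            nlinarith [(occ_mem_unit σ x).1, (occ_mem_unit σ x).2, (occ_mem_unit σ y).1, (occ_mem_unit σ y).2]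
          rcases abs_cases (jPot W y σ - jMeanPot W N) with ⟨h, _⟩ | ⟨h, _⟩ <;> nlinarith [hC0 σ]
        rw [wmean_smul] at h1
        linarith
      have hexpo : -(4 * (E + 2 * Real.exp E))
          ≤ wmean (jAmp W N) (fun σ => occ σ x * occ σ y * (jPot W y σ - jMeanPot W N))
            / wmean (jAmp W N) (fun σ => occ σ x * occ σ y) := by
        rw [le_div_iff₀ hmC]
        nlinarith [mul_nonneg hK0 (by linarith : (0 : ℝ) ≤ 4 * wmean (jAmp W N) (fun σ => occ σ x * occ σ y) - 1)]
      have hlow : (1 / 4) * Real.exp (-(4 * (E + 2 * Real.exp E)))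
          ≤ wmean (jAmp W N) (fun σ => occ σ x * occ σ y
              * Real.exp (jPot W y σ - jMeanPot W N)) :=
        le_trans (mul_le_mul hC (Real.exp_le_exp.mpr hexpo) (Real.exp_pos _).le hmC.le) hJ
      have hcb := jAmp_caseC_bound W hWe hW0 hWnn N hN2 h2N hE hEF x y hxy
      have hVN : 0 < ((Fintype.card G : ℝ) - (N : ℝ)) * Real.exp (-E) := mul_pos (by linarith) (Real.exp_pos _)
      have hchain : (N : ℝ) * (Real.exp (-(E + 4 * (E + 2 * Real.exp E))) / 4)
          ≤ (N : ℝ) * probPH (jAmp W N) x y := by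
        calc (N : ℝ) * (Real.exp (-(E + 4 * (E + 2 * Real.exp E))) / 4)
            ≤ ((Fintype.card G : ℝ) - (N : ℝ)) * (Real.exp (-(E + 4 * (E + 2 * Real.exp E))) / 4) :=
              mul_le_mul_of_nonneg_right (by linarith) (by positivity)
          _ = ((Fintype.card G : ℝ) - (N : ℝ)) * Real.exp (-E) * ((1 / 4) * Real.exp (-(4 * (E + 2 * Real.exp E)))) := by
              rw [hexp1]; ring
          _ ≤ ((Fintype.card G : ℝ) - (N : ℝ)) * Real.exp (-E) * wmean (jAmp W N) (fun σ => occ σ x * occ σ y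
              * Real.exp (jPot W y σ - jMeanPot W N)) := mul_le_mul_of_nonneg_left hlow hVN.le
          _ ≤ (N : ℝ) * probPH (jAmp W N) x y := hcb
      have := le_of_mul_le_mul_left hchain (by linarith : (0 : ℝ) < (N : ℝ))
      linarith [Real.exp_pos (-(E + 4 * (E + 2 * Real.exp E)))]
    · -- CASE D
      have hD : 1 / 4 ≤ wmean (jAmp W N) (fun σ => (1 - occ σ x) * (1 - occ σ y)) := by
        linarith
      have hD0 : ∀ σ : G → Fin 2, 0 ≤ (1 - occ σ x) * (1 - occ σ y) := fun σ =>
        mul_nonneg (by linarith [(occ_mem_unit σ x).2]) (by linarith [(occ_mem_unit σ y).2])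
      have hmD : 0 < wmean (jAmp W N) (fun σ => (1 - occ σ x) * (1 - occ σ y)) := by linarith
      have hJ := wmean_mul_exp_ge (jAmp W N) (fun σ => (1 - occ σ x) * (1 - occ σ y))
        (fun σ => -(jPot W y σ - jMeanPot W N)) hZpos hD0 hmD
      have hDx : -(E + 2 * Real.exp E)
          ≤ wmean (jAmp W N) (fun σ => (1 - occ σ x) * (1 - occ σ y)
              * -(jPot W y σ - jMeanPot W N)) := by
        have h1 : wmean (jAmp W N) (fun σ => (-1) * |jPot W y σ - jMeanPot W N|)
            ≤ wmean (jAmp W N) (fun σ => (1 - occ σ x) * (1 - occ σ y)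
              * -(jPot W y σ - jMeanPot W N)) := by
          refine wmean_mono _ fun σ => ?_
          have hc1 : (1 - occ σ x) * (1 - occ σ y) ≤ 1 := by
            nlinarith [(occ_mem_unit σ x).1, (occ_mem_unit σ x).2, (occ_mem_unit σ y).1, (occ_mem_unit σ y).2]
          rcases abs_cases (jPot W y σ - jMeanPot W N) with ⟨h, _⟩ | ⟨h, _⟩ <;> nlinarith [hD0 σ]
        rw [wmean_smul] at h1
        linarith
      have hexpo : -(4 * (E + 2 * Real.exp E))
          ≤ wmean (jAmp W N) (fun σ => (1 - occ σ x) * (1 - occ σ y)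
              * -(jPot W y σ - jMeanPot W N))
            / wmean (jAmp W N) (fun σ => (1 - occ σ x) * (1 - occ σ y)) := by
        rw [le_div_iff₀ hmD]
        nlinarith [mul_nonneg hK0 (by linarith : (0 : ℝ)
          ≤ 4 * wmean (jAmp W N) (fun σ => (1 - occ σ x) * (1 - occ σ y)) - 1)]
      have hlow : (1 / 4) * Real.exp (-(4 * (E + 2 * Real.exp E)))
          ≤ wmean (jAmp W N) (fun σ => (1 - occ σ x) * (1 - occ σ y)
              * Real.exp (-(jPot W y σ - jMeanPot W N))) :=
        le_trans (mul_le_mul hD (Real.exp_le_exp.mpr hexpo) (Real.exp_pos _).le hmD.le) hJ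
      have hdb := jAmp_caseD_bound W hWe hW0 hWnn N hN2 h2N hEF x y hxy
      rw [hB] at hdb
      have hNe : 0 < (N : ℝ) * Real.exp (-E) := mul_pos (by linarith) (Real.exp_pos _)
      have hchain : ((Fintype.card G : ℝ) - (N : ℝ)) * (Real.exp (-(E + 4 * (E + 2 * Real.exp E))) / 8)
          ≤ ((Fintype.card G : ℝ) - (N : ℝ)) * probPH (jAmp W N) x y := by
        calc ((Fintype.card G : ℝ) - (N : ℝ)) * (Real.exp (-(E + 4 * (E + 2 * Real.exp E))) / 8)
            ≤ (N : ℝ) * (Real.exp (-(E + 4 * (E + 2 * Real.exp E))) / 4) := by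
              have : ((Fintype.card G : ℝ) - (N : ℝ)) ≤ 2 * (N : ℝ) := by linarith
              have hq : 0 ≤ Real.exp (-(E + 4 * (E + 2 * Real.exp E))) := (Real.exp_pos _).le
              nlinarith
          _ = (N : ℝ) * Real.exp (-E) * ((1 / 4) * Real.exp (-(4 * (E + 2 * Real.exp E)))) := by
              rw [hexp1]; ring
          _ ≤ (N : ℝ) * Real.exp (-E) * wmean (jAmp W N) (fun σ => (1 - occ σ x) * (1 - occ σ y)
              * Real.exp (-(jPot W y σ - jMeanPot W N))) := mul_le_mul_of_nonneg_left hlow hNe.le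
          _ ≤ ((Fintype.card G : ℝ) - (N : ℝ)) * probPH (jAmp W N) x y := hdb
      exact le_of_mul_le_mul_left hchain (by linarith : (0 : ℝ) < (Fintype.card G : ℝ) - (N : ℝ))

/-- The explicit condensate-floor exponent of the resampling route: `C(B,E) = (2E + 4e^E + B)/c₀(E)` with the
particle–hole floor `c₀(E) = e^{−(E + 4(E + 2e^E))}/8`. [folklore] -/
def resamplingConst (B E : ℝ) : ℝ :=
  (2 * E + 4 * Real.exp E + B) / (Real.exp (-(E + 4 * (E + 2 * Real.exp E))) / 8)

/-- **END-TO-END WITH ONE HYPOTHESIS (PROVED, kernel-generic):** the energy floor alone gives the condensate floor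
`n₀/|G| ≥ (N/|G|)(1 − N/|G|)·exp(−C(B,E)/2)` for the canonical Jastrow state of any even kernel `0 ≤ W ≤ B`,
`W 0 = 0`, `2 ≤ N`, `2N ≤ |G| ≤ 3N`. (theory seat Sketch9 Part P′ `condensate_of_energyFloor'`, generalised) [folklore] -/
theorem condensateDensity_jAmp_ge_of_energyFloor (W : G → ℝ) (hWe : ∀ z, W (-z) = W z) (hW0 : W 0 = 0)
    (hWnn : ∀ z, 0 ≤ W z) {B : ℝ} (hWB : ∀ z, W z ≤ B) (N : ℕ) (hN2 : 2 ≤ N) (h2N : 2 * N ≤ Fintype.card G)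
    (h3N : Fintype.card G ≤ 3 * N) {E : ℝ} (hE : 0 ≤ E) (hEF : JastrowEnergyFloor W N E) :
    ((N : ℝ) / Fintype.card G) * (1 - (N : ℝ) / Fintype.card G) * Real.exp (-(resamplingConst B E) / 2)
      ≤ condensateDensity (jAmp W N) := by
  unfold resamplingConst
  exact condensateDensity_jAmp_ge_of_floors W hWe hW0 hWnn hWB N hN2 h2N (by positivity) hE
    (jastrowParticleHoleFloor_of_energyFloor W hWe hW0 hWnn N hN2 h2N h3N hE hEF) hEF

/-- **END-TO-END FROM PSD ALONE (PROVED, kernel-generic):** `KernelPSDShift W D` with `D ≥ 0` gives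
`n₀/|G| ≥ (N/|G|)(1 − N/|G|)·exp(−C(B,D)/2)` for the canonical Jastrow state of any even kernel `0 ≤ W ≤ B`,
`W 0 = 0`, `2 ≤ N`, `2N ≤ |G| ≤ 3N` — Bose–Einstein condensation of the Rokhsar–Kivelson state from
positive-semidefiniteness of the pair kernel alone, with an `|G|`-independent floor.
(theory seat Sketch9 Part P′ `condensate_of_PSD'`, generalised) [folklore] -/
theorem condensateDensity_jAmp_ge_of_psd (W : G → ℝ) (hWe : ∀ z, W (-z) = W z) (hW0 : W 0 = 0)
    (hWnn : ∀ z, 0 ≤ W z) {B : ℝ} (hWB : ∀ z, W z ≤ B) (N : ℕ) (hN2 : 2 ≤ N) (h2N : 2 * N ≤ Fintype.card G)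
    (h3N : Fintype.card G ≤ 3 * N) {D : ℝ} (hD : 0 ≤ D) (hPSD : KernelPSDShift W D) :
    ((N : ℝ) / Fintype.card G) * (1 - (N : ℝ) / Fintype.card G) * Real.exp (-(resamplingConst B D) / 2)
      ≤ condensateDensity (jAmp W N) :=
  condensateDensity_jAmp_ge_of_energyFloor W hWe hW0 hWnn hWB N hN2 h2N h3N hD
    (jastrowEnergyFloor_of_psd W hWe N D hD (by omega) hPSD)

end JastrowParticleHole

section HalfFilling

open Literature.Probability.LatticeModels

/-- Half-filling numerology on `(ℤ/L)²`, `L ≥ 2`: `2 ≤ ⌊L²/2⌋`, `2⌊L²/2⌋ ≤ |Λ| ≤ 3⌊L²/2⌋`. [folklore] -/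
theorem halfFilling_numerology (L : ℕ) [NeZero L] (hL : 2 ≤ L) :
    2 ≤ L ^ 2 / 2 ∧ 2 * (L ^ 2 / 2) ≤ Fintype.card (TorusSite 2 L) ∧ Fintype.card (TorusSite 2 L) ≤ 3 * (L ^ 2 / 2) := by
  have hcardN : Fintype.card (TorusSite 2 L) = L ^ 2 := by rw [Fintype.card_fun, ZMod.card, Fintype.card_fin]
  have hsq : 4 ≤ L ^ 2 := by nlinarith
  rw [hcardN]; omega

end HalfFilling

end Summit.HubbardSuperconductivity.HubbardSuperconductivity.Theorems.AnisotropyChord.InsertionEntropy
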